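import Summits.Ventures.HodgeRepro2.T6B1Carriers

/-!
# T6B1Local — kernel-proved local facts for Tier-6 sub-goal B1 (proof lane)

Elementary facts about the §63B Hilbert symbol and the §65A local norms, proved outright (no display):

* the local norms `x² − θ y²` form a subgroup of `L^×` (TIER4 B1 (N4));
* O'Meara 63:10 (p0168 ll. 30–32: «α ∈ N_{E/F}E if and only if (α,β/𝔭) = 1», E = F(√β)) — the equivalence (N2) of
  TIER4 B1.2 — in any field of characteristic ≠ 2: `isNormFrom_iff_hilbertEqnSolvable`;
* the real place: for `t < 0`, `(a, t) = 1 ⟺ a > 0`, `t` is not a square, the local norms are the positive reals;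
* transport of the symbol / squares along ring isomorphisms (to read `K_w ≃ ℝ`);
* the determinant of a hermitian matrix over `R[ω]/(ω² = θ)` lies in `R` when `2` is a unit of `R`;
* the norm commutes with `extMap`, and a norm is a local norm.
-/

namespace Summit.Ventures.HodgeRepro2.T6
namespace B1Local

open B1Carriers Matrix

section field
variable {L : Type*} [Field L]

/-- `1` is a local norm. -/
theorem isNormFrom_one (θ : L) : IsNormFrom L θ 1 := ⟨1, 0, by ring⟩

/-- Local norms are closed under multiplication: `(x² − θy²)(x'² − θy'²) = (xx' + θyy')² − θ(xy' + x'y)²`. -/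
theorem IsNormFrom.mul {θ α β : L} (ha : IsNormFrom L θ α) (hb : IsNormFrom L θ β) :
    IsNormFrom L θ (α * β) := by
  obtain ⟨x, y, rfl⟩ := ha
  obtain ⟨x', y', rfl⟩ := hb
  exact ⟨x * x' + θ * y * y', x * y' + x' * y, by ring⟩

/-- Local norms are closed under inversion: `α⁻¹ = (x/α)² − θ (y/α)²`. -/
theorem IsNormFrom.inv {θ α : L} (ha : IsNormFrom L θ α) : IsNormFrom L θ α⁻¹ := by
  obtain ⟨x, y, rfl⟩ := ha
  by_cases h : x ^ 2 - θ * y ^ 2 = 0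
  · rw [h, _root_.inv_zero]
    exact ⟨0, 0, by ring⟩
  · refine ⟨x / (x ^ 2 - θ * y ^ 2), y / (x ^ 2 - θ * y ^ 2), ?_⟩
    field_simp

/-- A norm `N(z) = z.re² − θ z.im²` is a local norm. -/
theorem isNormFrom_norm (θ : L) (z : Ext L θ) : IsNormFrom L θ (QuadraticAlgebra.norm z) :=
  ⟨z.re, z.im, by simp only [QuadraticAlgebra.norm_def]; ring⟩

/-- If `α = f · n` with `n` a local norm, then `f` is a local norm iff `α` is. -/
theorem isNormFrom_iff_of_mul {θ α f n : L} (h : α = f * n) (hn : IsNormFrom L θ n) (hn0 : n ≠ 0) :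
    IsNormFrom L θ f ↔ IsNormFrom L θ α := by
  constructor
  · intro hf; rw [h]; exact IsNormFrom.mul hf hn
  · intro hα
    have : f = α * n⁻¹ := by rw [h]; field_simp
    rw [this]; exact IsNormFrom.mul hα (IsNormFrom.inv hn)

/-- O'Meara 63:10 (p0168 ll. 30–32), «α ∈ N_{E/F}E if and only if (α,β/𝔭) = 1» for `E = F(√β)`, proved in any field of
characteristic ≠ 2: a non-zero `α` is of the form `x² − θ y²` iff `α ξ² + θ η² = 1` is solvable. -/
theorem isNormFrom_iff_hilbertEqnSolvable (h2 : (2 : L) ≠ 0) {θ α : L} (hα : α ≠ 0) :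
    IsNormFrom L θ α ↔ HilbertEqnSolvable L α θ := by
  constructor
  · rintro ⟨x, y, rfl⟩
    by_cases hx : x = 0
    · subst hx
      have hy : y ≠ 0 := by rintro rfl; simp at hα
      have hθ : θ ≠ 0 := by rintro rfl; simp at hα
      refine ⟨(1 - 1 / θ) / (2 * y), (1 + 1 / θ) / 2, ?_⟩
      field_simp
      ring
    · refine ⟨1 / x, y / x, ?_⟩
      field_simp
      ring
  · rintro ⟨ξ, η, hξη⟩
    by_cases hξ : ξ = 0
    · subst hξ
      have hη : η ≠ 0 := by rintro rfl; simp at hξη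
      have hθ : θ = (1 / η) ^ 2 := by
        field_simp
        linear_combination hξη
      refine ⟨(α + 1) / 2, η * (1 - α) / 2, ?_⟩
      rw [hθ]
      field_simp
      ring
    · refine ⟨1 / ξ, η / ξ, ?_⟩
      field_simp
      linear_combination hξη

/-- The symbol is `1` iff the equation is solvable. -/
theorem hilbertSymbol_eq_one_iff (α β : L) : hilbertSymbol L α β = 1 ↔ HilbertEqnSolvable L α β := by
  unfold hilbertSymbol
  split_ifs with h
  · simp [h]
  · simp [h]

/-- The symbol is `−1` iff the equation is not solvable. -/
theorem hilbertSymbol_eq_neg_one_iff (α β : L) : hilbertSymbol L α β = -1 ↔ ¬ HilbertEqnSolvable L α β := by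
  unfold hilbertSymbol
  split_ifs with h
  · simp [h]
  · simp [h]

/-- The symbol takes the values `1` and `−1` only. -/
theorem hilbertSymbol_eq_one_or (α β : L) : hilbertSymbol L α β = 1 ∨ hilbertSymbol L α β = -1 := by
  unfold hilbertSymbol
  split_ifs <;> simp

/-- If `α = f · n` with `n ≠ 0` a local norm (and `α ≠ 0`, `2 ≠ 0`), the symbols `(f, θ)` and `(α, θ)` agree. -/
theorem hilbertSymbol_eq_of_mul_isNormFrom (h2 : (2 : L) ≠ 0) {θ α f n : L} (hα : α ≠ 0) (h : α = f * n)
    (hn : IsNormFrom L θ n) (hn0 : n ≠ 0) : hilbertSymbol L f θ = hilbertSymbol L α θ := by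
  have hf : f ≠ 0 := by rintro rfl; simp at h; exact hα h
  have key : HilbertEqnSolvable L f θ ↔ HilbertEqnSolvable L α θ := by
    rw [← isNormFrom_iff_hilbertEqnSolvable h2 hf, ← isNormFrom_iff_hilbertEqnSolvable h2 hα]
    exact isNormFrom_iff_of_mul h hn hn0
  unfold hilbertSymbol
  by_cases hs : HilbertEqnSolvable L f θ
  · rw [if_pos hs, if_pos (key.1 hs)]
  · rw [if_neg hs, if_neg (fun h' => hs (key.2 h'))]

/-- The symbol `(n, θ)` of a non-zero local norm `n` is `1`. -/
theorem hilbertSymbol_eq_one_of_isNormFrom (h2 : (2 : L) ≠ 0) {θ n : L} (hn : IsNormFrom L θ n) (hn0 : n ≠ 0) :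
    hilbertSymbol L n θ = 1 :=
  (hilbertSymbol_eq_one_iff n θ).2 ((isNormFrom_iff_hilbertEqnSolvable h2 hn0).1 hn)

end field

section transport
variable {L L' : Type*} [Field L] [Field L']

/-- Solvability of `αξ² + βη² = 1` is invariant under ring isomorphisms. -/
theorem hilbertEqnSolvable_map_iff (e : L ≃+* L') (α β : L) :
    HilbertEqnSolvable L' (e α) (e β) ↔ HilbertEqnSolvable L α β := by
  constructor
  · rintro ⟨ξ, η, h⟩
    refine ⟨e.symm ξ, e.symm η, ?_⟩
    apply e.injective
    simpa [map_add, map_mul, map_pow] using h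
  · rintro ⟨ξ, η, h⟩
    refine ⟨e ξ, e η, ?_⟩
    simp only [← map_pow, ← map_mul, ← map_add, h, map_one]

/-- The symbol is invariant under ring isomorphisms. -/
theorem hilbertSymbol_map (e : L ≃+* L') (α β : L) : hilbertSymbol L' (e α) (e β) = hilbertSymbol L α β := by
  unfold hilbertSymbol
  by_cases h : HilbertEqnSolvable L α β
  · rw [if_pos h, if_pos ((hilbertEqnSolvable_map_iff e α β).2 h)]
  · rw [if_neg h, if_neg (fun h' => h ((hilbertEqnSolvable_map_iff e α β).1 h'))]

/-- Squares are invariant under ring isomorphisms. -/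
theorem isSquare_map_iff (e : L ≃+* L') (a : L) : IsSquare (e a) ↔ IsSquare a := by
  constructor
  · rintro ⟨r, hr⟩
    exact ⟨e.symm r, by apply e.injective; simpa [map_mul] using hr⟩
  · rintro ⟨r, rfl⟩
    exact ⟨e r, by simp [map_mul]⟩

end transport

section real

/-- A negative real number is not a square. -/
theorem not_isSquare_of_neg {t : ℝ} (ht : t < 0) : ¬ IsSquare t := by
  rintro ⟨r, hr⟩
  have : 0 ≤ r * r := mul_self_nonneg r
  linarith

/-- At a real place with `t < 0`: `a ξ² + t η² = 1` is solvable iff `a > 0`. -/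
theorem hilbertEqnSolvable_real_iff {t a : ℝ} (ht : t < 0) : HilbertEqnSolvable ℝ a t ↔ 0 < a := by
  constructor
  · rintro ⟨ξ, η, h⟩
    by_contra hle
    have hle' : a ≤ 0 := not_lt.1 hle
    have h1 : a * ξ ^ 2 ≤ 0 := mul_nonpos_of_nonpos_of_nonneg hle' (sq_nonneg ξ)
    have h2 : t * η ^ 2 ≤ 0 := mul_nonpos_of_nonpos_of_nonneg ht.le (sq_nonneg η)
    linarith
  · intro ha
    refine ⟨1 / Real.sqrt a, 0, ?_⟩
    rw [div_pow, one_pow, Real.sq_sqrt ha.le, mul_one_div_cancel ha.ne']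
    ring

/-- At a real place with `t < 0`: the symbol `(a, t)` is `1` iff `a > 0`. -/
theorem hilbertSymbol_real_eq_one_iff {t a : ℝ} (ht : t < 0) : hilbertSymbol ℝ a t = 1 ↔ 0 < a := by
  rw [hilbertSymbol_eq_one_iff, hilbertEqnSolvable_real_iff ht]

/-- At a real place with `t < 0`: the symbol `(a, t)` is `−1` iff `a < 0` (for `a ≠ 0`). -/
theorem hilbertSymbol_real_eq_neg_one_iff {t a : ℝ} (ht : t < 0) (ha : a ≠ 0) :
    hilbertSymbol ℝ a t = -1 ↔ a < 0 := by
  rw [hilbertSymbol_eq_neg_one_iff, hilbertEqnSolvable_real_iff ht]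
  constructor
  · intro h; exact lt_of_le_of_ne (not_lt.1 h) ha
  · intro h; exact not_lt.2 h.le

/-- At a real place with `t < 0`, the local norms `x² − t y²` are exactly the non-negative reals; a non-zero one is
positive. -/
theorem isNormFrom_real_iff {t a : ℝ} (ht : t < 0) : IsNormFrom ℝ t a ↔ 0 ≤ a := by
  constructor
  · rintro ⟨x, y, rfl⟩
    have : 0 ≤ -t * y ^ 2 := mul_nonneg (by linarith) (sq_nonneg y)
    nlinarith [sq_nonneg x]
  · intro ha
    exact ⟨Real.sqrt a, 0, by rw [Real.sq_sqrt ha]; ring⟩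

end real

section det
variable {R : Type*} [CommRing R]

/-- The norm commutes with `extMap`. -/
theorem norm_extMap {S : Type*} [CommRing S] (f : R →+* S) {θ : R} {θ' : S} (h : f θ = θ') (z : Ext R θ) :
    QuadraticAlgebra.norm (extMap f h z) = f (QuadraticAlgebra.norm z) := by
  simp [QuadraticAlgebra.norm_def, h]

/-- The imaginary part of the determinant of a hermitian matrix over `R[ω]/(ω² = θ)` vanishes when `2` is a unit. -/
theorem det_im_eq_zero_of_isHermitian {θ : R} {n : ℕ} {M : Matrix (Fin n) (Fin n) (Ext R θ)} (hM : M.IsHermitian)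
    (h2 : IsUnit (2 : R)) : M.det.im = 0 := by
  have h := congrArg Matrix.det hM
  rw [Matrix.det_conjTranspose] at h
  have him : (star M.det).im = M.det.im := congrArg QuadraticAlgebra.im h
  rw [QuadraticAlgebra.im_star] at him
  have : M.det.im * 2 = 0 := by linear_combination (-1 : R) * him
  exact (h2.mul_left_eq_zero).1 this

/-- The determinant of a hermitian matrix over `R[ω]/(ω² = θ)` is the image of its real part. -/
theorem det_eq_algebraMap_re_of_isHermitian {θ : R} {n : ℕ} {M : Matrix (Fin n) (Fin n) (Ext R θ)}
    (hM : M.IsHermitian) (h2 : IsUnit (2 : R)) :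
    M.det = algebraMap R (Ext R θ) M.det.re := by
  ext
  · rfl
  · simp [det_im_eq_zero_of_isHermitian hM h2]

end det

end B1Local
end Summit.Ventures.HodgeRepro2.T6
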